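import Summits.QuantumFields.BalabanUV.T4Continuum.Support.NE3CovariantCalculus

/-!
# T⁴ programme, node NE3 — THE COVARIANT LATTICE WEITZENBÖCK INEQUALITY AT A SMALL-FIELD BACKGROUND (HS currency):
# gradient energy = curl energy + divergence energy up to a CURVATURE COMMUTATOR remainder `≤ 2·d·a·‖A‖²`
# (supplier piece E-MLw-w4-W under row E-MLw-w4, file 2∕2; file 1∕2 = `NE3CovariantCalculus`)

NE3 (node U1b) formalisation swarm, leaf seat `b2b-balaban-t4-ne3-formalise-leaf-03` (gen 6), supplier piece **E-MLw-w4-W**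
(INTENT `HOME/CLAIMS.log` 2026-08-20) under row E-MLw-w4 of `HOME/t4/formal/NE3/LEAVES.md` (owner skeleton v1.9 §4b, leaf
(ML_w) `NE3EnergyWeightedShapes.WeightedTangentCoercive`).  The FLAT identity is leaf (w2), `NE3LatticeWeitzenbock` (leaf-02-g4,
p219171): on the periodic lattice `Σ‖∇Y‖² = Σ‖curl Y‖² + Σ‖div Y‖²` exactly, because lattice differences commute.  The core of
(w4) — the weighted Poincaré–Hodge inequality at the CURVED background `W = cavg L U_B` — needs the same bookkeeping with
COVARIANT differences, which do NOT commute: their commutator is conjugation by a plaquette variable (file 1∕2, `norm_comm_le`),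
of size `‖W(∂p) − 1‖ ≤ a`.

WHAT IS PROVED ([folklore]; ONE unitary configuration; nothing about minimisers):
* §4 **`covariant_weitzenbock`**: for unitary `P`-periodic `V` with `‖V(∂p) − 1‖ ≤ a` at every plaquette and a `P`-periodic
  site-framed 1-form `A`, `|G − C − Div| ≤ 2·d·a·Σ_{x∈periodBox P} Σ_κ ‖A x κ‖²` with the covariant gradient energy
  `G = Σ_x Σ_μ Σ_ν nhsNormSq (cD V μ A_ν x)`, the covariant curl energy `C = Σ_x Σ_{μ<ν} nhsNormSq (cD V μ A_ν x − cD V ν A_μ x)`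
  ([Balaban1985BackgroundPropagators] (3.4) TYPE) and the covariant divergence energy `Div = Σ_x nhsNormSq (cdiv V A x)`;
  the two one-sided forms `covariant_weitzenbock_le`;
* §5 the DIRECTION-FIELD form in row NE3-R2's vocabulary (`AveragingDeficitCovGrad.covFd`, p218999): with the site framing
  `frame V ψ x ν := Ad_{V(x,ν)} ψ(x,ν)` one has `cD V μ (frame V ψ · ν) x = covFd V ψ x μ ν`, `cdiv V (frame V ψ) = covDiv V ψ`
  with `covDiv V ψ x := Σ_μ (Ad_{V(x,μ)} ψ(x,μ) − ψ(x−e_μ,μ))` (= `NE3CoercivityScaling.flatDiv ψ x` at the flat configuration,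
  `covDiv_flatCfg`), `‖frame V ψ x ν‖ = ‖ψ x ν‖`; **`covariant_weitzenbock_dir`** and the CONSUMER END
  **`sum_nhsNormSq_covFd_le`**: `Σ_x Σ_μ Σ_ν nhsNormSq (covFd V ψ x μ ν) ≤ 2·Σ_{p∈plaqsOf} nhsNormSq (curl V ψ p)
  + Σ_x nhsNormSq (covDiv V ψ x) + (2·d·a + 32·d·a²)·dirSq ψ (periodBox P)` (the dressed curl against the antisymmetrised covariant
  gradient by NE3-R2's `curlAt_eq_covFd_sub_add` ∕ `norm_curlRem_le` — the reverse direction of their `curlSq_le_covGradSq`, with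
  the divergence displayed), and the operator-norm corollary **`covGradSq_le`** for NE3-R2's `covGradSq`.
In the η-weighted currency of (R3) the `a`-terms read `(a·L^{2k})·(L^k)⁻²·dirSq` — harmless in the chart regime `a = O(L^{−2k})`;
the divergence term is whatever slice condition the tangent space carries (full or projected Landau, cf. F-ne3leaf03g6-1).

HONEST FRAMING.  OUR proof frame (context only, nothing printed is a hypothesis: [Balaban1985BackgroundPropagators] §A
(3.3)–(3.4), (3.8)–(3.10) «Δ = D*D + Δ′» with Δ′ small; [Balaban1984PropagatorsI] (1.21)∕(1.69) flat); NOT the weighted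
Poincaré–Hodge inequality (P_W), NOT (ML_w), NOT T-E_w; NE3 NOT proved; spine PROVED 0∕9; finite T⁴ rung (B)+1 — NOT infinite
volume, NOT mass gap, NOT BetaPertH, NOT Clay.  PLACEMENT: `Summits/QuantumFields/BalabanUV/`; imports file 1∕2 only.
-/
set_option autoImplicit false

open scoped BigOperators Matrix Matrix.Norms.L2Operator
open NormedSpace Finset

namespace Summit.QuantumFields.BalabanUV.T4Continuum.NE3CovariantWeitzenbock

open Literature.MathematicalPhysics.QuantumFieldTheory.Balaban1983to89
open B7Prop1Explicit B7Prop2Explicit MatrixLog UnitaryModel MatrixNorms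
open T4AveragingDeficitWall hiding Site Plane Plaq Bond
open T4AveragingDeficitWallBoundary (periodBox sum_periodBox_shift IsPeriodicCfg)
open T4AveragingDeficitNonAbelian (Ad_mul Ad_sub)
open AveragingDeficitPeriodicCounting (IsPeriodicDir)
open AveragingDeficitTransport (norm_Ad_of_unitary mem_U1_of_unitary val_inv_eq_star_of_unitary)
open AveragingDeficitNearIdentity (Ad_one norm_Ad_sub_le nReTr_Ad Ad_mul_Ad abs_nReTr_mul_le)
open AveragingDeficitCovGrad (covFd covGradSq curlRem curlAt_eq_covFd_sub_add norm_curlRem_le hol_plaqWord_units units_id₂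
  sum_plane_le_sum_pair)
open NE3HessShapes (plaqsOf sum_plaqsOf)
open NE3LatticeWeitzenbock (sum_sum_eq_two_mul_sum_plane)
open MinimalActionWitness (flatCfg)
open NE3CovariantCalculus

noncomputable section

variable {d : ℕ} {n : Type*} [Fintype n] [DecidableEq n]


/-! ## §4 The covariant Weitzenböck inequality for site-framed 1-forms -/

section Weitzenbock

/-- Per-direction period sums of a periodic 1-form are shift invariant. [folklore] -/
theorem sum_shift_sq {P : ℕ} {A : Site d → Fin d → (Matrix n n ℂ)} (hP : 1 ≤ P) (hA : ∀ (x : Site d) (κ ν : Fin d), A (x + (P : ℤ) • e κ) ν = A x ν)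
    (v : Site d) (ν : Fin d) :
    ∑ x ∈ periodBox (d := d) P, ‖A (x + v) ν‖ ^ 2 = ∑ x ∈ periodBox (d := d) P, ‖A x ν‖ ^ 2 :=
  sum_periodBox_shift (d := d) P hP (g := fun x => ‖A x ν‖ ^ 2) (fun x κ => by simp only [hA x κ ν]) v

/-- **THE CROSS TERM**: `G − C = X`, where `X = Σ_x Σ_μ Σ_ν hsR (cD μ A_ν x) (cD ν A_μ x)` (plane bookkeeping by
`NE3LatticeWeitzenbock.sum_sum_eq_two_mul_sum_plane`). [folklore] -/
theorem grad_sub_curl_eq_cross (F : Finset (Site d)) (V : Site d → Fin d → (Matrix n n ℂ)ˣ) (A : Site d → Fin d → (Matrix n n ℂ)) :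
    (∑ x ∈ F, ∑ μ : Fin d, ∑ ν : Fin d, nhsNormSq (cD V μ (fun y => A y ν) x))
      - ∑ x ∈ F, ∑ π : T4AveragingDeficitWall.Plane d,
          nhsNormSq (cD V π.1.1 (fun y => A y π.1.2) x - cD V π.1.2 (fun y => A y π.1.1) x)
      = ∑ x ∈ F, ∑ μ : Fin d, ∑ ν : Fin d, hsR (cD V μ (fun y => A y ν) x) (cD V ν (fun y => A y μ) x) := by
  have hx : ∀ x ∈ F, (∑ μ : Fin d, ∑ ν : Fin d, nhsNormSq (cD V μ (fun y => A y ν) x))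
      - ∑ π : T4AveragingDeficitWall.Plane d,
          nhsNormSq (cD V π.1.1 (fun y => A y π.1.2) x - cD V π.1.2 (fun y => A y π.1.1) x)
      = ∑ μ : Fin d, ∑ ν : Fin d, hsR (cD V μ (fun y => A y ν) x) (cD V ν (fun y => A y μ) x) := by
    intro x _
    set g : Fin d → Fin d → ℝ := fun μ ν => nhsNormSq (cD V μ (fun y => A y ν) x - cD V ν (fun y => A y μ) x) with hg
    have hdiag : ∀ μ, g μ μ = 0 := fun μ => by simp [hg, MatrixNorms.nhsNormSq]
    have hsymm : ∀ μ ν, g μ ν = g ν μ := fun μ ν => by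
      simp only [hg]; rw [← nhsNormSq_neg, neg_sub]
    have h2 := sum_sum_eq_two_mul_sum_plane g hdiag hsymm
    -- expand `g` by the parallelogram identity and symmetrise
    have hexp : ∑ μ : Fin d, ∑ ν : Fin d, g μ ν
        = 2 * ∑ μ : Fin d, ∑ ν : Fin d, nhsNormSq (cD V μ (fun y => A y ν) x)
          - 2 * ∑ μ : Fin d, ∑ ν : Fin d, hsR (cD V μ (fun y => A y ν) x) (cD V ν (fun y => A y μ) x) := by
      have hsym2 : ∑ μ : Fin d, ∑ ν : Fin d, nhsNormSq (cD V ν (fun y => A y μ) x)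
          = ∑ μ : Fin d, ∑ ν : Fin d, nhsNormSq (cD V μ (fun y => A y ν) x) := Finset.sum_comm
      simp only [hg, nhsNormSq_sub, Finset.sum_add_distrib, Finset.sum_sub_distrib, ← Finset.mul_sum]
      rw [hsym2]; ring
    have hplane : ∑ π : T4AveragingDeficitWall.Plane d,
        nhsNormSq (cD V π.1.1 (fun y => A y π.1.2) x - cD V π.1.2 (fun y => A y π.1.1) x)
        = ∑ π : T4AveragingDeficitWall.Plane d, g π.1.1 π.1.2 := rfl
    rw [hplane]
    linarith
  rw [← Finset.sum_sub_distrib]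
  exact Finset.sum_congr rfl hx

/-- **THE COVARIANT WEITZENBÖCK INEQUALITY** (site-framed form).  For `P ≥ 1`, unitary `P`-periodic `V` with
`‖V(∂p) − 1‖ ≤ a` at every plaquette, and a `P`-periodic site-framed 1-form `A`:
`|G − C − Div| ≤ 2·d·a·Σ_{x∈periodBox P} Σ_κ ‖A x κ‖²`, with the covariant gradient energy
`G = Σ_x Σ_μ Σ_ν nhsNormSq (cD V μ A_ν x)`, the covariant curl energy `C = Σ_x Σ_{μ<ν} nhsNormSq (cD V μ A_ν x − cD V ν A_μ x)`
and the covariant divergence energy `Div = Σ_x nhsNormSq (cdiv V A x)` (all in the normalised HS currency).  At a flat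
configuration (`a = 0`) this is the exact identity of leaf (w2). [folklore] -/
theorem covariant_weitzenbock [Nonempty n] {P : ℕ} {V : Site d → Fin d → (Matrix n n ℂ)ˣ} {A : Site d → Fin d → (Matrix n n ℂ)} {a : ℝ} (hP : 1 ≤ P) (hV : IsUnitaryCfg V) (hVP : IsPeriodicCfg V (P : ℤ))
    (hplaq : ∀ (z : Site d) (μ ν : Fin d), ‖((hol V z (plaqWord μ ν) : (Matrix n n ℂ)ˣ) : (Matrix n n ℂ)) - 1‖ ≤ a)
    (hA : ∀ (x : Site d) (κ ν : Fin d), A (x + (P : ℤ) • e κ) ν = A x ν) :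
    |(∑ x ∈ periodBox (d := d) P, ∑ μ : Fin d, ∑ ν : Fin d, nhsNormSq (cD V μ (fun y => A y ν) x))
        - (∑ x ∈ periodBox (d := d) P, ∑ π : T4AveragingDeficitWall.Plane d,
            nhsNormSq (cD V π.1.1 (fun y => A y π.1.2) x - cD V π.1.2 (fun y => A y π.1.1) x))
        - ∑ x ∈ periodBox (d := d) P, nhsNormSq (cdiv V A x)|
      ≤ 2 * d * a * ∑ x ∈ periodBox (d := d) P, ∑ κ : Fin d, ‖A x κ‖ ^ 2 := by
  have hAν : ∀ (ν : Fin d) (x : Site d) (κ : Fin d), (fun y => A y ν) (x + (P : ℤ) • e κ) = (fun y => A y ν) x :=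
    fun ν x κ => hA x κ ν
  -- Step A: `G − C = X`
  rw [grad_sub_curl_eq_cross]
  -- Step B: `X = Σ_{μν} Σ_x hsR (A_ν x) (cDstar μ (cD ν A_μ) x)`
  have hB : ∀ μ ν : Fin d, ∑ x ∈ periodBox (d := d) P, hsR (cD V μ (fun y => A y ν) x) (cD V ν (fun y => A y μ) x)
      = ∑ x ∈ periodBox (d := d) P, hsR (A x ν) (cDstar V μ (cD V ν (fun y => A y μ)) x) :=
    fun μ ν => sum_hsR_cD hP hV hVP μ (hAν ν) (cD_periodic hVP ν (f := fun y => A y μ) (hAν μ))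
  -- Step C: `Div = Σ_{μν} Σ_x hsR (A_ν x) (cD ν (cDstar μ A_μ) x)`
  have hC : ∑ x ∈ periodBox (d := d) P, nhsNormSq (cdiv V A x)
      = ∑ μ : Fin d, ∑ ν : Fin d, ∑ x ∈ periodBox (d := d) P, hsR (A x ν) (cD V ν (cDstar V μ (fun y => A y μ)) x) := by
    have hx : ∀ x : Site d, nhsNormSq (cdiv V A x)
        = ∑ μ : Fin d, ∑ ν : Fin d, hsR (cDstar V μ (fun y => A y μ) x) (cDstar V ν (fun y => A y ν) x) := by
      intro x
      rw [← hsR_self, cdiv_eq_neg_sum_cDstar]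
      have : hsR (-∑ μ : Fin d, cDstar V μ (fun y => A y μ) x) (-∑ μ : Fin d, cDstar V μ (fun y => A y μ) x)
          = hsR (∑ μ : Fin d, cDstar V μ (fun y => A y μ) x) (∑ μ : Fin d, cDstar V μ (fun y => A y μ) x) := by
        unfold hsR; rw [Matrix.conjTranspose_neg, neg_mul_neg]
      rw [this, hsR_sum_left]
      exact Finset.sum_congr rfl fun μ _ => hsR_sum_right _ _ _
    calc ∑ x ∈ periodBox (d := d) P, nhsNormSq (cdiv V A x)
        = ∑ x ∈ periodBox (d := d) P, ∑ μ : Fin d, ∑ ν : Fin d,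
            hsR (cDstar V μ (fun y => A y μ) x) (cDstar V ν (fun y => A y ν) x) := Finset.sum_congr rfl fun x _ => hx x
      _ = ∑ μ : Fin d, ∑ ν : Fin d, ∑ x ∈ periodBox (d := d) P,
            hsR (cDstar V μ (fun y => A y μ) x) (cDstar V ν (fun y => A y ν) x) := by
          rw [Finset.sum_comm]; exact Finset.sum_congr rfl fun μ _ => Finset.sum_comm
      _ = ∑ μ : Fin d, ∑ ν : Fin d, ∑ x ∈ periodBox (d := d) P, hsR (A x ν) (cD V ν (cDstar V μ (fun y => A y μ)) x) := by
          refine Finset.sum_congr rfl fun μ _ => Finset.sum_congr rfl fun ν _ => ?_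
          -- `Σ hsR F (cDstar ν G) = Σ hsR (cD ν F) G`, then symmetry, with `F = cDstar μ A_μ`, `G = A_ν`
          have h' := sum_hsR_cD hP hV hVP ν (f := cDstar V μ (fun y => A y μ)) (g := fun y => A y ν)
            (cDstar_periodic hVP μ (g := fun y => A y μ) (hAν μ)) (hAν ν)
          -- h' : Σ hsR (cD ν (cDstar μ A_μ) x) (A_ν x) = Σ hsR (cDstar μ A_μ x) (cDstar ν A_ν x)
          rw [← h']
          exact Finset.sum_congr rfl fun x _ => hsR_comm _ _
  -- Step D: the remainder `R = X − Div = Σ_{μν} Σ_x hsR (A_ν x) (commutator)`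
  have hX : ∑ x ∈ periodBox (d := d) P, ∑ μ : Fin d, ∑ ν : Fin d, hsR (cD V μ (fun y => A y ν) x) (cD V ν (fun y => A y μ) x)
      = ∑ μ : Fin d, ∑ ν : Fin d, ∑ x ∈ periodBox (d := d) P, hsR (A x ν) (cDstar V μ (cD V ν (fun y => A y μ)) x) := by
    rw [Finset.sum_comm]
    refine Finset.sum_congr rfl fun μ _ => ?_
    rw [Finset.sum_comm]
    exact Finset.sum_congr rfl fun ν _ => hB μ ν
  rw [hX, hC, ← Finset.sum_sub_distrib]
  simp_rw [← Finset.sum_sub_distrib, ← hsR_sub_right]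
  -- Step E: bound each (μ, ν) term after the shift `x = z + e_μ`
  have hterm : ∀ μ ν : Fin d,
      |∑ x ∈ periodBox (d := d) P, hsR (A x ν)
          (cDstar V μ (cD V ν (fun y => A y μ)) x - cD V ν (cDstar V μ (fun y => A y μ)) x)|
        ≤ a * (∑ x ∈ periodBox (d := d) P, ‖A x ν‖ ^ 2 + ∑ x ∈ periodBox (d := d) P, ‖A x μ‖ ^ 2) := by
    intro μ ν
    -- reindex by `z ↦ z + e μ`
    set T : Site d → ℝ := fun x => hsR (A x ν)
        (cDstar V μ (cD V ν (fun y => A y μ)) x - cD V ν (cDstar V μ (fun y => A y μ)) x) with hT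
    have hTper : ∀ (x : Site d) (κ : Fin d), T (x + (P : ℤ) • e κ) = T x := by
      intro x κ
      simp only [hT]
      rw [hA x κ ν, cDstar_periodic hVP μ (g := cD V ν (fun y => A y μ)) (cD_periodic hVP ν (f := fun y => A y μ) (hAν μ)),
        cD_periodic hVP ν (f := cDstar V μ (fun y => A y μ)) (cDstar_periodic hVP μ (g := fun y => A y μ) (hAν μ))]
    have hre := sum_periodBox_shift (d := d) P hP hTper (e μ)
    rw [← hre]
    refine (Finset.abs_sum_le_sum_abs _ _).trans ?_
    have hz : ∀ z ∈ periodBox (d := d) P, |T (z + e μ)| ≤ a * (‖A (z + e μ) ν‖ ^ 2 + ‖A (z + e ν) μ‖ ^ 2) := by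
      intro z _
      simp only [hT]
      refine (abs_hsR_le _ _).trans ?_
      have hc := norm_comm_le hV μ ν (fun y => A y μ) z (hplaq z μ ν)
      have h0 : 0 ≤ ‖A (z + e μ) ν‖ := norm_nonneg _
      have h1 : 0 ≤ ‖A (z + e ν) μ‖ := norm_nonneg _
      have ha0 : 0 ≤ a := (norm_nonneg _).trans (hplaq z μ ν)
      calc ‖A (z + e μ) ν‖ * ‖cDstar V μ (cD V ν (fun y => A y μ)) (z + e μ) - cD V ν (cDstar V μ (fun y => A y μ)) (z + e μ)‖
          ≤ ‖A (z + e μ) ν‖ * (2 * a * ‖A (z + e ν) μ‖) := mul_le_mul_of_nonneg_left hc h0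
        _ ≤ a * (‖A (z + e μ) ν‖ ^ 2 + ‖A (z + e ν) μ‖ ^ 2) := by
            nlinarith [sq_nonneg (‖A (z + e μ) ν‖ - ‖A (z + e ν) μ‖)]
    refine (Finset.sum_le_sum hz).trans (le_of_eq ?_)
    rw [← Finset.mul_sum, Finset.sum_add_distrib, sum_shift_sq hP hA (e μ) ν, sum_shift_sq hP hA (e ν) μ]
  -- sum the per-pair bounds
  refine (Finset.abs_sum_le_sum_abs _ _).trans ?_
  refine (Finset.sum_le_sum fun μ _ => (Finset.abs_sum_le_sum_abs _ _).trans (Finset.sum_le_sum fun ν _ => hterm μ ν)).trans ?_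
  -- evaluate: `Σ_μ Σ_ν a·(S_ν + S_μ) = 2·d·a·Σ_κ S_κ`
  set S : Fin d → ℝ := fun κ => ∑ x ∈ periodBox (d := d) P, ‖A x κ‖ ^ 2 with hS
  have hSsum : ∑ x ∈ periodBox (d := d) P, ∑ κ : Fin d, ‖A x κ‖ ^ 2 = ∑ κ : Fin d, S κ := by rw [Finset.sum_comm]
  rw [hSsum]
  have h1 : ∑ μ : Fin d, ∑ ν : Fin d, a * (S ν + S μ) = 2 * d * a * ∑ κ : Fin d, S κ := by
    have e1 : ∀ μ : Fin d, ∑ ν : Fin d, a * (S ν + S μ) = a * ∑ κ : Fin d, S κ + (d : ℝ) * (a * S μ) := by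
      intro μ
      rw [← Finset.mul_sum, Finset.sum_add_distrib, Finset.sum_const, Finset.card_univ, Fintype.card_fin, nsmul_eq_mul]
      ring
    rw [Finset.sum_congr rfl fun μ _ => e1 μ, Finset.sum_add_distrib, Finset.sum_const, Finset.card_univ, Fintype.card_fin,
      nsmul_eq_mul, ← Finset.mul_sum, ← Finset.mul_sum]
    ring
  rw [← h1]

/-- The two one-sided forms most consumers use: `G ≤ C + Div + 2da·‖A‖²` and `C + Div ≤ G + 2da·‖A‖²`. [folklore] -/
theorem covariant_weitzenbock_le [Nonempty n] {P : ℕ} {V : Site d → Fin d → (Matrix n n ℂ)ˣ} {A : Site d → Fin d → (Matrix n n ℂ)} {a : ℝ} (hP : 1 ≤ P) (hV : IsUnitaryCfg V) (hVP : IsPeriodicCfg V (P : ℤ))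
    (hplaq : ∀ (z : Site d) (μ ν : Fin d), ‖((hol V z (plaqWord μ ν) : (Matrix n n ℂ)ˣ) : (Matrix n n ℂ)) - 1‖ ≤ a)
    (hA : ∀ (x : Site d) (κ ν : Fin d), A (x + (P : ℤ) • e κ) ν = A x ν) :
    (∑ x ∈ periodBox (d := d) P, ∑ μ : Fin d, ∑ ν : Fin d, nhsNormSq (cD V μ (fun y => A y ν) x))
        ≤ (∑ x ∈ periodBox (d := d) P, ∑ π : T4AveragingDeficitWall.Plane d,
            nhsNormSq (cD V π.1.1 (fun y => A y π.1.2) x - cD V π.1.2 (fun y => A y π.1.1) x))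
          + ∑ x ∈ periodBox (d := d) P, nhsNormSq (cdiv V A x)
          + 2 * d * a * ∑ x ∈ periodBox (d := d) P, ∑ κ : Fin d, ‖A x κ‖ ^ 2 ∧
    (∑ x ∈ periodBox (d := d) P, ∑ π : T4AveragingDeficitWall.Plane d,
            nhsNormSq (cD V π.1.1 (fun y => A y π.1.2) x - cD V π.1.2 (fun y => A y π.1.1) x))
          + ∑ x ∈ periodBox (d := d) P, nhsNormSq (cdiv V A x)
        ≤ (∑ x ∈ periodBox (d := d) P, ∑ μ : Fin d, ∑ ν : Fin d, nhsNormSq (cD V μ (fun y => A y ν) x))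
          + 2 * d * a * ∑ x ∈ periodBox (d := d) P, ∑ κ : Fin d, ‖A x κ‖ ^ 2 := by
  have h := covariant_weitzenbock hP hV hVP hplaq hA
  rw [abs_le] at h
  constructor <;> linarith [h.1, h.2]

end Weitzenbock

/-! ## §5 The direction-field form (row NE3-R2's `covFd`) and the consumer END against the dressed curl -/

/-- THE SITE FRAMING of a direction field: `frame V ψ x ν := Ad_{V(x,ν)} ψ(x,ν)` (in the convention `V_s = V·e^{sψ}` the value
`ψ(x,ν)` lives at `x + e_ν`; `frame` transports it to `x`). [folklore] -/
def frame (V : Site d → Fin d → (Matrix n n ℂ)ˣ) (ψ : Site d → Fin d → (Matrix n n ℂ)) (x : Site d) (ν : Fin d) : (Matrix n n ℂ) := Ad (V x ν) (ψ x ν)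

/-- THE COVARIANT (BACKWARD) DIVERGENCE of a direction field at the background `V`:
`covDiv V ψ x = Σ_μ (Ad_{V(x,μ)} ψ(x,μ) − ψ(x−e_μ,μ))`; at the flat configuration it is `NE3CoercivityScaling.flatDiv ψ x`
(`Ad 1 = id`). [folklore] -/
def covDiv (V : Site d → Fin d → (Matrix n n ℂ)ˣ) (ψ : Site d → Fin d → (Matrix n n ℂ)) (x : Site d) : (Matrix n n ℂ) :=
  ∑ μ : Fin d, (Ad (V x μ) (ψ x μ) - ψ (x - e μ) μ)

/-- `cD V μ (frame V ψ · ν) x = covFd V ψ x μ ν`. [folklore] -/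
theorem cD_frame (V : Site d → Fin d → (Matrix n n ℂ)ˣ) (ψ : Site d → Fin d → (Matrix n n ℂ)) (x : Site d) (μ ν : Fin d) :
    cD V μ (fun y => frame V ψ y ν) x = covFd V ψ x μ ν := by
  unfold cD frame covFd
  rw [Ad_mul]

/-- `cdiv V (frame V ψ) x = covDiv V ψ x`. [folklore] -/
theorem cdiv_frame (V : Site d → Fin d → (Matrix n n ℂ)ˣ) (ψ : Site d → Fin d → (Matrix n n ℂ)) (x : Site d) :
    cdiv V (frame V ψ) x = covDiv V ψ x := by
  unfold cdiv frame covDiv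
  refine Finset.sum_congr rfl fun μ _ => ?_
  rw [← Ad_mul, inv_mul_cancel, Ad_one]

/-- At the flat configuration the covariant divergence is the backward divergence `Σ_μ (ψ(x,μ) − ψ(x−e_μ,μ))`
(= `NE3CoercivityScaling.flatDiv ψ x`, definitionally). [folklore] -/
theorem covDiv_flatCfg (ψ : Site d → Fin d → (Matrix n n ℂ)) (x : Site d) :
    covDiv (flatCfg (d := d) (n := n)) ψ x = ∑ μ : Fin d, (ψ x μ - ψ (x - e μ) μ) := by
  unfold covDiv
  simp [flatCfg, Ad_one]

/-- `‖frame V ψ x ν‖ = ‖ψ x ν‖` for unitary `V`. [folklore] -/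
theorem norm_frame {V : Site d → Fin d → (Matrix n n ℂ)ˣ} (hV : IsUnitaryCfg V) (ψ : Site d → Fin d → (Matrix n n ℂ)) (x : Site d) (ν : Fin d) :
    ‖frame V ψ x ν‖ = ‖ψ x ν‖ := norm_Ad_of_unitary (hV x ν) _

/-- The framing of periodic data is periodic. [folklore] -/
theorem frame_periodic {P : ℕ} {V : Site d → Fin d → (Matrix n n ℂ)ˣ} (hVP : IsPeriodicCfg V (P : ℤ)) {ψ : Site d → Fin d → (Matrix n n ℂ)}
    (hψ : IsPeriodicDir ψ (P : ℤ)) (x : Site d) (κ ν : Fin d) : frame V ψ (x + (P : ℤ) • e κ) ν = frame V ψ x ν := by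
  unfold frame
  rw [hVP x κ ν, hψ x κ ν]

/-- **THE COVARIANT WEITZENBÖCK INEQUALITY FOR DIRECTION FIELDS** (row NE3-R2's `covFd`): for `P ≥ 1`, unitary `P`-periodic
`V` with `‖V(∂p) − 1‖ ≤ a` at every plaquette, and a `P`-periodic direction field `ψ`:
`|Σ_x Σ_μ Σ_ν nhsNormSq (covFd V ψ x μ ν) − Σ_x Σ_{μ<ν} nhsNormSq (covFd V ψ x μ ν − covFd V ψ x ν μ)
  − Σ_x nhsNormSq (covDiv V ψ x)| ≤ 2·d·a·dirSq ψ (periodBox (d := d) P)`. [folklore] -/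
theorem covariant_weitzenbock_dir [Nonempty n] {P : ℕ} (hP : 1 ≤ P) {V : Site d → Fin d → (Matrix n n ℂ)ˣ} (hV : IsUnitaryCfg V)
    (hVP : IsPeriodicCfg V (P : ℤ)) {a : ℝ}
    (hplaq : ∀ (z : Site d) (μ ν : Fin d), ‖((hol V z (plaqWord μ ν) : (Matrix n n ℂ)ˣ) : (Matrix n n ℂ)) - 1‖ ≤ a)
    {ψ : Site d → Fin d → (Matrix n n ℂ)} (hψ : IsPeriodicDir ψ (P : ℤ)) :
    |(∑ x ∈ periodBox (d := d) P, ∑ μ : Fin d, ∑ ν : Fin d, nhsNormSq (covFd V ψ x μ ν))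
        - (∑ x ∈ periodBox (d := d) P, ∑ π : T4AveragingDeficitWall.Plane d,
            nhsNormSq (covFd V ψ x π.1.1 π.1.2 - covFd V ψ x π.1.2 π.1.1))
        - ∑ x ∈ periodBox (d := d) P, nhsNormSq (covDiv V ψ x)|
      ≤ 2 * d * a * dirSq ψ (periodBox (d := d) P) := by
  have h := covariant_weitzenbock (A := frame V ψ) hP hV hVP hplaq (fun x κ ν => frame_periodic hVP hψ x κ ν)
  simp only [cD_frame, cdiv_frame, norm_frame hV] at h
  unfold dirSq
  exact h

/-- The plaquette-radius hypothesis from `SmallField` (planes `μ ≠ ν`) and `a ≥ 0` (degenerate words `μ = ν` have holonomy `1`).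
[folklore] -/
theorem plaq_bound_of_smallField {V : Site d → Fin d → (Matrix n n ℂ)ˣ} {a : ℝ} (ha : 0 ≤ a) (hVa : SmallField V a)
    (z : Site d) (μ ν : Fin d) : ‖((hol V z (plaqWord μ ν) : (Matrix n n ℂ)ˣ) : (Matrix n n ℂ)) - 1‖ ≤ a := by
  by_cases hμν : μ = ν
  · subst hμν
    have h1 : hol V z (plaqWord μ μ) = 1 := by rw [hol_plaqWord_units]; group
    rw [h1, Units.val_one, sub_self, norm_zero]; exact ha
  · exact hVa z μ ν hμν

/-- **CONSUMER END — THE COVARIANT GRADIENT ENERGY AGAINST THE DRESSED CURL AND THE COVARIANT DIVERGENCE.**  For `P ≥ 1`,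
unitary `P`-periodic `V` in `SmallField V a` (`a ≥ 0`) and a `P`-periodic direction field `ψ`:
`Σ_x Σ_μ Σ_ν nhsNormSq (covFd V ψ x μ ν) ≤ 2·Σ_{p ∈ plaqsOf (periodBox (d := d) P)} nhsNormSq (curl V ψ p) + Σ_x nhsNormSq (covDiv V ψ x)
  + (2·d·a + 32·d·a²)·dirSq ψ (periodBox (d := d) P)` — §4 plus NE3-R2's curl identity `covFd_μν − covFd_νμ = curlAt − curlRem`,
`‖curlRem‖ ≤ 2a·(two bond values)`.  The reverse direction of NE3-R2's `curlSq_le_covGradSq`, with the divergence displayed.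
[folklore] -/
theorem sum_nhsNormSq_covFd_le [Nonempty n] {P : ℕ} (hP : 1 ≤ P) {V : Site d → Fin d → (Matrix n n ℂ)ˣ} (hV : IsUnitaryCfg V)
    (hVP : IsPeriodicCfg V (P : ℤ)) {a : ℝ} (ha : 0 ≤ a) (hVa : SmallField V a)
    {ψ : Site d → Fin d → (Matrix n n ℂ)} (hψ : IsPeriodicDir ψ (P : ℤ)) :
    ∑ x ∈ periodBox (d := d) P, ∑ μ : Fin d, ∑ ν : Fin d, nhsNormSq (covFd V ψ x μ ν)
      ≤ 2 * ∑ p ∈ plaqsOf (periodBox (d := d) P), nhsNormSq (curl V ψ p)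
        + ∑ x ∈ periodBox (d := d) P, nhsNormSq (covDiv V ψ x)
        + (2 * d * a + 32 * d * a ^ 2) * dirSq ψ (periodBox (d := d) P) := by
  have hplaq := plaq_bound_of_smallField ha hVa
  obtain ⟨hle, -⟩ := covariant_weitzenbock_le (A := frame V ψ) hP hV hVP hplaq (fun x κ ν => frame_periodic hVP hψ x κ ν)
  simp only [cD_frame, cdiv_frame, norm_frame hV] at hle
  -- the antisymmetrised covariant gradient against the dressed curl, plaquette by plaquette
  have hpt : ∀ (x : Site d) (π : T4AveragingDeficitWall.Plane d),
      nhsNormSq (covFd V ψ x π.1.1 π.1.2 - covFd V ψ x π.1.2 π.1.1)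
        ≤ 2 * nhsNormSq (curl V ψ (x, π)) + 16 * a ^ 2 * (‖ψ (x + e π.1.2) π.1.1‖ ^ 2 + ‖ψ x π.1.2‖ ^ 2) := by
    intro x π
    have hid : covFd V ψ x π.1.1 π.1.2 - covFd V ψ x π.1.2 π.1.1 = curl V ψ (x, π) - curlRem V ψ x π.1.1 π.1.2 := by
      rw [show curl V ψ (x, π) = curlAt V ψ x π.1.1 π.1.2 from rfl, curlAt_eq_covFd_sub_add]; abel
    rw [hid]
    refine (nhsNormSq_sub_le _ _).trans ?_
    have hR := norm_curlRem_le hV ψ x (μ := π.1.1) (ν := π.1.2) (hplaq x π.1.1 π.1.2)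
    have hR0 : 0 ≤ ‖curlRem V ψ x π.1.1 π.1.2‖ := norm_nonneg _
    have hR2 : nhsNormSq (curlRem V ψ x π.1.1 π.1.2) ≤ (2 * a * (‖ψ (x + e π.1.2) π.1.1‖ + ‖ψ x π.1.2‖)) ^ 2 :=
      (nhsNormSq_le_opNorm_sq _).trans (pow_le_pow_left₀ hR0 hR 2)
    nlinarith [sq_nonneg (‖ψ (x + e π.1.2) π.1.1‖ - ‖ψ x π.1.2‖)]
  -- sum over the period and the planes
  have hshift : ∀ (ν μ : Fin d), ∑ x ∈ periodBox (d := d) P, ‖ψ (x + e ν) μ‖ ^ 2 = ∑ x ∈ periodBox (d := d) P, ‖ψ x μ‖ ^ 2 :=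
    fun ν μ => sum_periodBox_shift P hP (g := fun x => ‖ψ x μ‖ ^ 2) (fun x κ => by simp only [hψ x κ μ]) (e ν)
  set S : Fin d → ℝ := fun κ => ∑ x ∈ periodBox (d := d) P, ‖ψ x κ‖ ^ 2 with hS
  have hS0 : ∀ κ, 0 ≤ S κ := fun κ => by rw [hS]; positivity
  have hdir : dirSq ψ (periodBox (d := d) P) = ∑ κ : Fin d, S κ := by unfold dirSq; rw [Finset.sum_comm]
  have hC : ∑ x ∈ periodBox (d := d) P, ∑ π : T4AveragingDeficitWall.Plane d, nhsNormSq (covFd V ψ x π.1.1 π.1.2 - covFd V ψ x π.1.2 π.1.1)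
      ≤ 2 * ∑ p ∈ plaqsOf (periodBox (d := d) P), nhsNormSq (curl V ψ p) + 32 * d * a ^ 2 * dirSq ψ (periodBox (d := d) P) := by
    have e3 : ∑ x ∈ periodBox (d := d) P, ∑ π : T4AveragingDeficitWall.Plane d, (‖ψ (x + e π.1.2) π.1.1‖ ^ 2 + ‖ψ x π.1.2‖ ^ 2)
        = ∑ π : T4AveragingDeficitWall.Plane d, (S π.1.1 + S π.1.2) := by
      rw [Finset.sum_comm]
      refine Finset.sum_congr rfl fun π _ => ?_
      rw [Finset.sum_add_distrib, hshift π.1.2 π.1.1]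
    have e4 : ∑ x ∈ periodBox (d := d) P, ∑ π : T4AveragingDeficitWall.Plane d,
          (2 * nhsNormSq (curl V ψ (x, π)) + 16 * a ^ 2 * (‖ψ (x + e π.1.2) π.1.1‖ ^ 2 + ‖ψ x π.1.2‖ ^ 2))
        = 2 * ∑ p ∈ plaqsOf (periodBox (d := d) P), nhsNormSq (curl V ψ p)
            + 16 * a ^ 2 * ∑ π : T4AveragingDeficitWall.Plane d, (S π.1.1 + S π.1.2) := by
      rw [sum_plaqsOf, ← e3, Finset.mul_sum, Finset.mul_sum, ← Finset.sum_add_distrib]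
      refine Finset.sum_congr rfl fun x _ => ?_
      rw [Finset.mul_sum, Finset.mul_sum, ← Finset.sum_add_distrib]
    calc ∑ x ∈ periodBox (d := d) P, ∑ π : T4AveragingDeficitWall.Plane d,
          nhsNormSq (covFd V ψ x π.1.1 π.1.2 - covFd V ψ x π.1.2 π.1.1)
        ≤ ∑ x ∈ periodBox (d := d) P, ∑ π : T4AveragingDeficitWall.Plane d,
            (2 * nhsNormSq (curl V ψ (x, π)) + 16 * a ^ 2 * (‖ψ (x + e π.1.2) π.1.1‖ ^ 2 + ‖ψ x π.1.2‖ ^ 2)) :=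
          Finset.sum_le_sum fun x _ => Finset.sum_le_sum fun π _ => hpt x π
      _ = 2 * ∑ p ∈ plaqsOf (periodBox (d := d) P), nhsNormSq (curl V ψ p)
            + 16 * a ^ 2 * ∑ π : T4AveragingDeficitWall.Plane d, (S π.1.1 + S π.1.2) := e4
      _ ≤ 2 * ∑ p ∈ plaqsOf (periodBox (d := d) P), nhsNormSq (curl V ψ p) + 32 * d * a ^ 2 * dirSq ψ (periodBox (d := d) P) := by
          have hpl := sum_plane_le_sum_pair (fun μ ν => S μ + S ν) (fun μ ν => add_nonneg (hS0 μ) (hS0 ν))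
          have hpair : ∑ μ : Fin d, ∑ ν : Fin d, (S μ + S ν) = 2 * d * ∑ κ : Fin d, S κ := by
            have e1 : ∀ μ : Fin d, ∑ ν : Fin d, (S μ + S ν) = (d : ℝ) * S μ + ∑ κ : Fin d, S κ := by
              intro μ
              rw [Finset.sum_add_distrib, Finset.sum_const, Finset.card_univ, Fintype.card_fin, nsmul_eq_mul]
            rw [Finset.sum_congr rfl fun μ _ => e1 μ, Finset.sum_add_distrib, Finset.sum_const, Finset.card_univ,
              Fintype.card_fin, nsmul_eq_mul, ← Finset.mul_sum]
            ring
          rw [hdir]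
          have ha2 : 0 ≤ 16 * a ^ 2 := by positivity
          nlinarith [mul_le_mul_of_nonneg_left hpl ha2]
  rw [show (∑ x ∈ periodBox (d := d) P, ∑ κ : Fin d, ‖ψ x κ‖ ^ 2) = dirSq ψ (periodBox (d := d) P) from rfl] at hle
  nlinarith [hle, hC]

/-- The operator-norm corollary for NE3-R2's `covGradSq` (`‖X‖² ≤ card n · nhsNormSq X`): under the same hypotheses,
`covGradSq V ψ (periodBox (d := d) P) ≤ card n · (2·Σ nhsNormSq (curl V ψ ·) + Σ nhsNormSq (covDiv V ψ ·) + (2da + 32da²)·dirSq ψ)`.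
[folklore] -/
theorem covGradSq_le [Nonempty n] {P : ℕ} (hP : 1 ≤ P) {V : Site d → Fin d → (Matrix n n ℂ)ˣ} (hV : IsUnitaryCfg V)
    (hVP : IsPeriodicCfg V (P : ℤ)) {a : ℝ} (ha : 0 ≤ a) (hVa : SmallField V a)
    {ψ : Site d → Fin d → (Matrix n n ℂ)} (hψ : IsPeriodicDir ψ (P : ℤ)) :
    covGradSq V ψ (periodBox (d := d) P)
      ≤ (Fintype.card n : ℝ) * (2 * ∑ p ∈ plaqsOf (periodBox (d := d) P), nhsNormSq (curl V ψ p)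
        + ∑ x ∈ periodBox (d := d) P, nhsNormSq (covDiv V ψ x)
        + (2 * d * a + 32 * d * a ^ 2) * dirSq ψ (periodBox (d := d) P)) := by
  have h := sum_nhsNormSq_covFd_le hP hV hVP ha hVa hψ
  have hcard : (0 : ℝ) ≤ (Fintype.card n : ℝ) := Nat.cast_nonneg _
  calc covGradSq V ψ (periodBox (d := d) P)
      ≤ ∑ x ∈ periodBox (d := d) P, ∑ μ : Fin d, ∑ ν : Fin d, (Fintype.card n : ℝ) * nhsNormSq (covFd V ψ x μ ν) := by
        unfold covGradSq
        exact Finset.sum_le_sum fun x _ => Finset.sum_le_sum fun μ _ => Finset.sum_le_sum fun ν _ =>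
          opNorm_sq_le_card_mul_nhsNormSq _
    _ = (Fintype.card n : ℝ) * ∑ x ∈ periodBox (d := d) P, ∑ μ : Fin d, ∑ ν : Fin d, nhsNormSq (covFd V ψ x μ ν) := by
        simp only [Finset.mul_sum]
    _ ≤ _ := mul_le_mul_of_nonneg_left h hcard

end

end Summit.QuantumFields.BalabanUV.T4Continuum.NE3CovariantWeitzenbock
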